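import Literature.MathematicalPhysics.QuantumFieldTheory.Balaban1983to89.B5G183RateSum

/-!
# Bałaban [CMP 95 (1984)] (1.83) at `U = 1`: the **OPERATOR-LEVEL η-RATE `O(1/N)`** of the fibre of
`G = Δ_a⁻¹` — `‖G^{(RN)}(p′) − ι_* G^{(N)}(p′) ι^*‖_{ℓ²→ℓ²} ≤ Cop(d,a)/N` by a Schur test over the alias
sums of `B5G183RateSum` (linear theory, explicit constants, no conditionals)
(v1.0.1, DOCSTRING-ONLY: the exponential-decay locator in NOT-CLAIMED (iv) is Prop. 1.2 (1.110)–(1.111)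
p. 35 (render ref1 p019 read as image; XREAD journal l.52371 item R2), not Prop. 1.1 p. 33; no declaration changed.)

HONEST FRAMING (cell `pub-balaban`, T⁴ programme, estimate NE2 = U1a «η-rate, linear theory»).  This module
is about ONE explicit finite-dimensional object: the fibre matrix, at a fixed reduced momentum `p′ ≠ 0` of
the zone, of Bałaban's momentum representation (1.83) of `G = Δ_a⁻¹` ([Balaban1984PropagatorsI] p. 31) for
the TRIVIAL background `U = 1` on a FINITE torus with `η = 1/n`, exactly as typed by the b05 line
(`B5Prop11Fiber.balabanFiber`, index set `(ℤ/n)^d × Fin d` = alias classes × directions).  Nothing here is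
infinite-volume, nothing is a mass gap, nothing is uniform in a coupling, and nothing in this file is
progress on any Clay problem or on the summit statement of this programme; it is elementary finite-
dimensional linear algebra (a Schur test) on top of the alias sums of the sibling module `B5G183RateSum`,
with OUR constants.  All theorems are tagged `[folklore]`: the object is Bałaban's (1.83), the uniform
operator bound is Bałaban's Prop. 1.1 (typed by b05 as `B5Prop11Fiber.opNorm_G_le`, cited here BY NAME and
not re-proved), the replacement-and-alias-sum mechanism of the RATE is King's [King1986] §4 p. 672; the
«planting» of the level-`N` fibre on the level-`RN` classes, the Schur-test packaging and every constant are
ours and are NOT attributed to either author.  `[cite: …]` tags locate TEXT, never a proof.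

WHAT IS PRINTED (renders read by this seat: [Balaban1984PropagatorsI] pp. 31–33; [King1986] p. 672).
Bałaban p. 31, (1.83): the fibre of `G` at `p′` in the index `(l, μ)` is
`δ_{μν}[δ_{ll′}/Δ(p′+l) − a·conj(u v_μ)(p′+l)·φ_μ⁻¹(p′)·(u v_μ)(p′+l′)/(Δ(p′+l)Δ(p′+l′))]`
`  + b(l,μ)·a⁻¹(Σ_λ|∂_{1,λ}(p′)|²/φ_λ(p′))⁻¹·conj b(l′,ν)`.  p. 32: «We will prove that G is a bounded
operator by transforming the formula (1.83) in a manner similar to that applied in the formula (1.63) for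
the operator H_k.» … «Using all the properties of the functions appearing above, e.g. the inequality (1.36),
we can easily prove that this expression defines a bounded operator on L²(T_η).»  p. 33: «Proposition 1.1.
The operator G is a symmetric operator on L²(T_η) and ‖GJ‖, ‖∇GJ‖, ‖G∇*J‖, ‖∇G∇*J‖, ‖∇∇GJ‖, ‖G∇*∇*J‖
≤ γ₀⁻¹‖J‖, (1.89) with a positive constant γ₀ independent of k, T_η, and depending on d only (if we put
a = 1). This implies the bound from below: Δ_a = G⁻¹ ≥ γ₀(Δ + I). (1.90)».  NO η-RATE of `G` is printed by
Bałaban.  King p. 672 (scalar `U(1)` Higgs model, the η-rate of his kernels): «Also `m ∈ 2πL^kZ^d` and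
`|m_μ| ≤ πL^k(L^n − 1)` for L odd»; (4.21) `|Δ^{(k+n)}(p′)Δ^{η′}(p′+l+m)⁻¹| ≤ C|p′|²|p′+l+m|⁻²`; «so the
sum over l, m is bounded by (4.22) `Σ_{l,m}|p′+l+m|^{α−1}Π_μ|(p′+l+m)_μ|⁻¹ ≤ C` for `α < 1`.»; «We first
bound the terms in (4.19) with `m ≠ 0` as follows: … `≤ CL^{−γk}`» (4.23); «To analyze the `m = 0` term in
(4.19), we successively replace each factor by the corresponding one … and bound the error.»

WHAT IS TYPED HERE (all at `m² = 0`, `U = 1`, levels `N ≥ 1` and `RN`, `R ≥ 1`, `a > 0`, `p′ = s` with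
`|s_ν| ≤ π`, `s ≠ 0`; level-`N` classes `k` are PAIRED with the level-`RN` classes `ιk`,
`ι = B5Hk163Rate.iota` (same representative `q_k`, `B5Hk163Rate.symmAlias_iota`; King's `m = 0`), the other
level-`RN` classes are UNPAIRED (`m ≠ 0`, `‖q″‖ ≥ πN`)).
 §0 the SCHUR TEST on `ℓ²` of a finite index set, for the `L²`-operator norm of `Matrix` (scoped
    `Matrix.Norms.L2Operator`, via `MatrixNorms.opNorm_le_of_bound` and b05's `B5Prop11Bound.l2n`): row
    sums and column sums of `|X_{ij}|` `≤ C` ⇒ `‖X‖ ≤ C`; Hermitian version (columns = rows).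
 §1 PLANTING: `plant R s M` puts a level-`N` matrix `M` (index `(ℤ/N)^d × Fin d`) on the level-`RN` index
    set — entry `M_{(k,μ),(k′,ν)}` at `((ιk,μ),(ιk′,ν))`, zero on unpaired rows and columns (`unpair` inverts
    `ι` on its image, `B5Hk163Rate.iota_injective`); planting preserves hermiticity.
 §2 the entry formula `Gfor` of (1.83) at the symmetric representatives and its identification with b05's
    fibre matrix (`G_entry`, from `B5G183Rate.fiber_G_entry_eq`); the `(0,0)` x-corner is (1.87)'s
    `Δ(p′)⁻¹ − dZ(p′)` (`xEnt_zero_zero`, `B5G183Rate.diag_zero_eq`) with η-rate `≤ Cxz·N⁻²`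
    (`B5G183Rate.dZ_rate'` + the rate of `Δ(p′)⁻¹`); entrywise majorants of `Gfor` and of the paired
    difference `Gfor^{(RN)}(ιk,ιk′) − Gfor^{(N)}(k,k′)`.
 §3 ROW SUMS of `D = G^{(RN)}(p′) − plant(G^{(N)}(p′))`: a PAIRED row `(ιk,μ)` has paired part
    `≤ (π²/24 + Cxz)N⁻² + (CX0r + CXr + d·CRr)/N` (free diagonal per mode `B5G183RateSum.diag_paired_rate`,
    x-block rows `xBlock_rows_rate` / `xBlock_row0_rate` + corner, rank-one block `rBlock_rate`) and unpaired
    part `≤ (KX·SXu + d((4d+a)/a)SB·SBu)/N` (`xBlock_unpaired_cols_le`, `rBlock_unpaired_cols_le`); an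
    UNPAIRED row `(k″,μ)` (plant row zero) is `≤ (4N²)⁻¹ + (SXu·KX + d((4d+a)/a)SBu·SB)/N`
    (`diag_unpaired_le`, `xBlock_unpaired_rows_le`, `rBlock_unpaired_rows_le`).  The free diagonal is NOT
    summable over the classes, but a row meets exactly ONE diagonal entry — this is why the operator rate
    goes through the Schur test and not through a total entrywise `ℓ¹` bound.
 §4 `Cop(d,a) = Cpr + Cur` (explicit polynomial in the constants of `B5G183RateSum`, `B5G183Rate`,
    `King1986.aliasConst`, `γ₀ = T4GaugeActionRate.gam0 d`), every row sum of `|D|` is `≤ Cop/N`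
    (`row_sum_le`), `D` is Hermitian (b05's `B5Prop11Fiber.G_isHermitian` + `plant_isHermitian`), hence the
    MAIN THEOREM `opNorm_G_rate : ‖G^{(RN)}(p′) − plant(G^{(N)}(p′))‖ ≤ Cop(d,a)/N`, and side by side with
    b05's uniform bound `opNorm_G_le_and_rate : ‖G^{(N)}(p′)‖ ≤ gamma0 d a ∧ ‖G^{(RN)} − plant G^{(N)}‖ ≤ Cop/N`.
 Every hypothesis of every theorem is `1 ≤ N`, `1 ≤ R` (`1 ≤ R·N`), `0 < a`, `|s_ν| ≤ π`, `s ≠ 0`; there is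
 NO perturbative / background / (B), (B^μ) / `BetaPertH` conditional anywhere in this file (linear theory,
 `U = 1`), and the η-currency is `1/N` with no loss.

WHAT IS NOT CLAIMED (typed residuals, owners wanted — see the cell records): (i) the printed DERIVATIVE
forms of (1.89) (`∇G`, `G∇*`, `∇G∇*`, `∇∇G`, `G∇*∇*`) and their rates — b05 types the uniform sandwich bounds
(`B5Prop11Fiber.opNorm_sandwich_G_le_of_orders`), no sandwich RATE is typed here; (ii) derivatives in `p′`
(«differentiated two times at most», p. 32) and hence position-space decay of the rate kernel; (iii) the
identification of the planted matrix with a block of an operator on `L²(T_{η})` for two different `η`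
(the pairing `ι` is King's `m = 0` identification of alias classes at a fixed `p′`; no statement about
functions on the torus is typed); (iv) `U ≠ 1`, (1.99), the exponential decay of Prop. 1.2 ((1.110)–(1.111) p. 35, § F; Prop. 1.1 p. 33 is the `L²` bound
(1.89)–(1.90), NOT a decay statement) and the later papers;
(v) optimality of `Cop` (a crude sum of products of the sibling constants).
-/

noncomputable section

namespace Literature.MathematicalPhysics.QuantumFieldTheory.Balaban1983to89.B5G183RateOp

open scoped BigOperators ComplexConjugate Matrix.Norms.L2Operator
open Finset Complex
open Literature.MathematicalPhysics.QuantumFieldTheory.Balaban1983to89.B4Strip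
open Literature.MathematicalPhysics.QuantumFieldTheory.Balaban1983to89.B5Prop11Leaves
open Literature.MathematicalPhysics.QuantumFieldTheory.Balaban1983to89.B5Prop11Fiber
open Literature.MathematicalPhysics.QuantumFieldTheory.Balaban1983to89.B5Prop11Bound
  (Fiber l2n l2n_nonneg l2n_sq l2n_le_of_sq_le norm_eq_l2n toEuclideanCLM_apply)
open Literature.MathematicalPhysics.QuantumFieldTheory.Balaban1983to89.B5ActionRate166 (Cphi Cpsi)
open Literature.MathematicalPhysics.QuantumFieldTheory.Balaban1983to89.B5Hk163Rate
open Literature.MathematicalPhysics.QuantumFieldTheory.Balaban1983to89.B5Hk163RateSum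
open Literature.MathematicalPhysics.QuantumFieldTheory.Balaban1983to89.B5G183Rate
open Literature.MathematicalPhysics.QuantumFieldTheory.Balaban1983to89.B5G183RateSum
open Literature.MathematicalPhysics.QuantumFieldTheory.King1986

variable {d : ℕ}

/-! ## §0 The Schur test on `ℓ²` of a finite index set [folklore] -/

section Schur

variable {ι : Type*} [Fintype ι]

/-- weighted Cauchy–Schwarz: `|Σ_j X_j ψ_j|² ≤ (Σ_j |X_j|)·(Σ_j |X_j|·|ψ_j|²)`. [folklore] -/
theorem norm_sum_mul_sq_le (X ψ : ι → ℂ) :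
    ‖∑ j, X j * ψ j‖ ^ 2 ≤ (∑ j, ‖X j‖) * ∑ j, ‖X j‖ * ‖ψ j‖ ^ 2 := by
  have h1 : ‖∑ j, X j * ψ j‖ ≤ ∑ j, ‖X j‖ * ‖ψ j‖ :=
    (norm_sum_le _ _).trans_eq (Finset.sum_congr rfl fun j _ => norm_mul _ _)
  have h2 : (∑ j, Real.sqrt ‖X j‖ * (Real.sqrt ‖X j‖ * ‖ψ j‖)) ^ 2
      ≤ (∑ j, Real.sqrt ‖X j‖ ^ 2) * ∑ j, (Real.sqrt ‖X j‖ * ‖ψ j‖) ^ 2 :=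
    Finset.sum_mul_sq_le_sq_mul_sq _ _ _
  have e1 : ∀ j, Real.sqrt ‖X j‖ * (Real.sqrt ‖X j‖ * ‖ψ j‖) = ‖X j‖ * ‖ψ j‖ := fun j => by
    rw [← mul_assoc, Real.mul_self_sqrt (norm_nonneg _)]
  have e2 : ∀ j, Real.sqrt ‖X j‖ ^ 2 = ‖X j‖ := fun j => Real.sq_sqrt (norm_nonneg _)
  have e3 : ∀ j, (Real.sqrt ‖X j‖ * ‖ψ j‖) ^ 2 = ‖X j‖ * ‖ψ j‖ ^ 2 := fun j => by
    rw [mul_pow, e2]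
  simp only [e1, e2, e3] at h2
  have h0 : 0 ≤ ∑ j, ‖X j‖ * ‖ψ j‖ :=
    Finset.sum_nonneg fun j _ => mul_nonneg (norm_nonneg _) (norm_nonneg _)
  calc ‖∑ j, X j * ψ j‖ ^ 2 ≤ (∑ j, ‖X j‖ * ‖ψ j‖) ^ 2 := pow_le_pow_left₀ (norm_nonneg _) h1 2
    _ ≤ _ := h2

/-- for a Hermitian matrix the column sums of `|X_{ij}|` are the row sums. [folklore] -/
theorem col_sum_eq_row_sum_of_isHermitian {X : Matrix ι ι ℂ} (hX : X.IsHermitian) (j : ι) :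
    ∑ i, ‖X i j‖ = ∑ i, ‖X j i‖ := by
  refine Finset.sum_congr rfl fun i _ => ?_
  rw [← hX.apply i j, Complex.star_def, Complex.norm_conj]

variable [DecidableEq ι]

/-- **Schur test**: if every row sum and every column sum of `|X_{ij}|` is `≤ C`, then the
`ℓ² → ℓ²` operator norm satisfies `‖X‖ ≤ C`. [folklore] -/
theorem opNorm_le_of_schur (X : Matrix ι ι ℂ) {C : ℝ} (hC : 0 ≤ C)
    (hr : ∀ i, ∑ j, ‖X i j‖ ≤ C) (hc : ∀ j, ∑ i, ‖X i j‖ ≤ C) : ‖X‖ ≤ C := by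
  refine MatrixNorms.opNorm_le_of_bound X hC fun ψ => ?_
  rw [norm_eq_l2n (Matrix.toEuclideanCLM (n := ι) (𝕜 := ℂ) X ψ), norm_eq_l2n ψ]
  have hψ := l2n_nonneg (fun i => ψ i)
  refine l2n_le_of_sq_le (mul_nonneg hC hψ) ?_
  rw [mul_pow, l2n_sq]
  have hw : ∀ i, 0 ≤ ∑ j, ‖X i j‖ * ‖ψ j‖ ^ 2 := fun i =>
    Finset.sum_nonneg fun j _ => mul_nonneg (norm_nonneg _) (sq_nonneg _)
  have step1 : ∑ i, ‖(Matrix.toEuclideanCLM (n := ι) (𝕜 := ℂ) X ψ) i‖ ^ 2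
      ≤ ∑ i, C * ∑ j, ‖X i j‖ * ‖ψ j‖ ^ 2 := by
    refine Finset.sum_le_sum fun i _ => ?_
    rw [toEuclideanCLM_apply]
    exact (norm_sum_mul_sq_le _ _).trans (mul_le_mul_of_nonneg_right (hr i) (hw i))
  have step2 : ∑ i, C * ∑ j, ‖X i j‖ * ‖ψ j‖ ^ 2 = C * ∑ j, (∑ i, ‖X i j‖) * ‖ψ j‖ ^ 2 := by
    rw [← Finset.mul_sum, Finset.sum_comm]
    congr 1
    refine Finset.sum_congr rfl fun j _ => ?_
    rw [Finset.sum_mul]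
  have step3 : ∑ j, (∑ i, ‖X i j‖) * ‖ψ j‖ ^ 2 ≤ ∑ j, C * ‖ψ j‖ ^ 2 :=
    Finset.sum_le_sum fun j _ => mul_le_mul_of_nonneg_right (hc j) (sq_nonneg _)
  calc ∑ i, ‖(Matrix.toEuclideanCLM (n := ι) (𝕜 := ℂ) X ψ) i‖ ^ 2
      ≤ C * ∑ j, (∑ i, ‖X i j‖) * ‖ψ j‖ ^ 2 := step1.trans_eq step2
    _ ≤ C * ∑ j, C * ‖ψ j‖ ^ 2 := mul_le_mul_of_nonneg_left step3 hC
    _ = C ^ 2 * ∑ j, ‖(fun i => ψ i) j‖ ^ 2 := by rw [← Finset.mul_sum]; ring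

/-- **Schur test, Hermitian case**: row sums `≤ C` suffice. [folklore] -/
theorem opNorm_le_of_schur_isHermitian {X : Matrix ι ι ℂ} (hX : X.IsHermitian) {C : ℝ} (hC : 0 ≤ C)
    (hr : ∀ i, ∑ j, ‖X i j‖ ≤ C) : ‖X‖ ≤ C :=
  opNorm_le_of_schur X hC hr fun j => (col_sum_eq_row_sum_of_isHermitian hX j).trans_le (hr j)

end Schur

/-! ## §1 Planting a level-`N` fibre matrix on the level-`RN` classes along King's pairing `ι` [folklore] -/

section Plant

variable {N R : ℕ} [NeZero R]

/-- the partial inverse of King's pairing: `unpair k″ = some k` iff `k″ = ι k`, `none` on the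
UNPAIRED classes (`|m| ≥ 1` in King's (4.19)). [cite: King1986, (4.19) p.672] [folklore] -/
def unpair (R : ℕ) [NeZero R] (s : Fin d → ℝ) (k'' : Fin d → Fin (R * N)) : Option (Fin d → Fin N) :=
  if h : ∃ k : Fin d → Fin N, iota R k s = k'' then some h.choose else none

/-- `unpair (ι k) = some k`. [folklore] -/
theorem unpair_iota (hN : 1 ≤ N) {s : Fin d → ℝ} (hs : ∀ ν, |s ν| ≤ Real.pi) (k : Fin d → Fin N) :
    unpair R s (iota R k s) = some k := by
  have h : ∃ k₁ : Fin d → Fin N, iota R k₁ s = iota R k s := ⟨k, rfl⟩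
  unfold unpair
  rw [dif_pos h]
  congr 1
  exact iota_injective hN hs h.choose_spec

/-- `unpair k″ = none` on an unpaired class. [folklore] -/
theorem unpair_of_unpaired {s : Fin d → ℝ} {k'' : Fin d → Fin (R * N)}
    (hu : ∀ k : Fin d → Fin N, iota R k s ≠ k'') : unpair R s k'' = none := by
  unfold unpair
  rw [dif_neg]
  push Not
  exact hu

/-- **planting** `ι_* M ι^*`: the level-`N` matrix `M` on the alias classes, transported to the
level-`RN` classes along `ι × id` and extended by `0` on the unpaired classes. [folklore] -/
def plant (R : ℕ) [NeZero R] (s : Fin d → ℝ)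
    (M : Matrix ((Fin d → Fin N) × Fin d) ((Fin d → Fin N) × Fin d) ℂ) :
    Matrix ((Fin d → Fin (R * N)) × Fin d) ((Fin d → Fin (R * N)) × Fin d) ℂ := fun i j =>
  match unpair R s i.1, unpair R s j.1 with
  | some k, some k' => M (k, i.2) (k', j.2)
  | _, _ => 0

/-- planted entries at paired classes. [folklore] -/
theorem plant_iota_iota (hN : 1 ≤ N) {s : Fin d → ℝ} (hs : ∀ ν, |s ν| ≤ Real.pi)
    (M : Matrix ((Fin d → Fin N) × Fin d) ((Fin d → Fin N) × Fin d) ℂ)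
    (k k' : Fin d → Fin N) (μ ν : Fin d) :
    plant R s M (iota R k s, μ) (iota R k' s, ν) = M (k, μ) (k', ν) := by
  unfold plant
  simp only [unpair_iota hN hs]

/-- planted entries vanish on unpaired rows. [folklore] -/
theorem plant_row_unpaired {s : Fin d → ℝ}
    (M : Matrix ((Fin d → Fin N) × Fin d) ((Fin d → Fin N) × Fin d) ℂ)
    {k'' : Fin d → Fin (R * N)} (hu : ∀ k : Fin d → Fin N, iota R k s ≠ k'') (μ : Fin d)
    (j : (Fin d → Fin (R * N)) × Fin d) : plant R s M (k'', μ) j = 0 := by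
  unfold plant
  simp only [unpair_of_unpaired hu]

/-- planted entries vanish on unpaired columns. [folklore] -/
theorem plant_col_unpaired {s : Fin d → ℝ}
    (M : Matrix ((Fin d → Fin N) × Fin d) ((Fin d → Fin N) × Fin d) ℂ)
    (i : (Fin d → Fin (R * N)) × Fin d) {l'' : Fin d → Fin (R * N)}
    (hu : ∀ k : Fin d → Fin N, iota R k s ≠ l'') (ν : Fin d) : plant R s M i (l'', ν) = 0 := by
  unfold plant
  simp only [unpair_of_unpaired hu]
  cases unpair R s i.1 <;> rfl

/-- planting preserves hermiticity. [folklore] -/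
theorem plant_isHermitian {s : Fin d → ℝ}
    {M : Matrix ((Fin d → Fin N) × Fin d) ((Fin d → Fin N) × Fin d) ℂ} (hM : M.IsHermitian) :
    (plant R s M).IsHermitian := by
  refine Matrix.IsHermitian.ext fun i j => ?_
  unfold plant
  cases hi : unpair R s i.1 <;> cases hj : unpair R s j.1 <;> simp [hM.apply]

end Plant

/-! ## §2 The entries of Bałaban's fibre matrix at the symmetric representatives; the `(0,0)` corner [folklore] -/

section Entries

variable {n N R : ℕ} [NeZero n] [NeZero N] [NeZero R]

/-- the entry formula of (1.83) at the symmetric representatives `q_k = symmAlias n k p′` of the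
alias classes: `G_{(k,μ),(k′,ν)} = [μ = ν]([k = k′]·Δ^{(n)}(q_k)⁻¹ − xEnt_μ(k,k′)) + rEnt_{μν}(k,k′)`
(`xEnt`, `rEnt` = the x-block / rank-one entries of `B5G183RateSum`).
[cite: Balaban1984PropagatorsI, (1.83) p.31] [folklore] -/
def Gfor (n : ℕ) [NeZero n] (a : ℝ) (s : Fin d → ℝ) (μ ν : Fin d) (k k' : Fin d → Fin n) : ℂ :=
  (if μ = ν then
      ((if k = k' then (((DeltaXir n 0 (symmAlias n k s) : ℝ) : ℂ))⁻¹ else 0) - xEnt n a μ s k k')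
    else 0) + rEnt n a μ ν s k k'

/-- **the fibre matrix of b05 (`B5Prop11Fiber.balabanFiber`) entrywise equals `Gfor`** — the
identification `B5G183Rate.fiber_G_entry_eq` at the symmetric representatives
(`B5Hk163Rate.isRep_symmAlias`). [cite: Balaban1984PropagatorsI, (1.83) p.31] [folklore] -/
theorem G_entry (hn : 1 ≤ n) (a : ℝ) (ha : 0 < a) {s : Fin d → ℝ} (hs : ∀ ν, |s ν| ≤ Real.pi)
    (hs0 : s ≠ 0) (k k' : Fin d → Fin n) (μ ν : Fin d) :
    (balabanFiber n hn a ha s hs hs0).G (k, μ) (k', ν) = Gfor n a s μ ν k k' :=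
  fiber_G_entry_eq hn a ha s hs hs0 (isRep_symmAlias hn k hs) (isRep_symmAlias hn k' hs) μ ν

/-- the `(0,0)` x-corner through (1.87): `xEnt^{(n)}_μ(0,0) = Δ^{(n)}(p′)⁻¹ − dZ^{(n)}_μ(p′)`
(`B5G183Rate.diag_zero_eq`). [cite: Balaban1984PropagatorsI, (1.87) p.32] [folklore] -/
theorem xEnt_zero_zero (hn : 1 ≤ n) (a : ℝ) (ha : 0 < a) (μ : Fin d) {s : Fin d → ℝ}
    (hs : ∀ ν, |s ν| ≤ Real.pi) (hs0 : s ≠ 0) :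
    xEnt n a μ s 0 0 = (((DeltaXir n 0 s : ℝ) : ℂ))⁻¹ - ((dZ n a μ s : ℝ) : ℂ) := by
  have h := diag_zero_eq hn a ha s hs hs0 μ
  unfold xEnt
  rw [symmAlias_zero hn hs]
  linear_combination (-1 : ℂ) * h

/-- the constant of `B5G183Rate.dZ_rate'` (η-rate of (1.87)). [folklore] -/
def Cdz (d : ℕ) (a : ℝ) : ℝ :=
  CS1 / T4GaugeActionRate.gam0 d + (1 + a / 4) * (4 * d)
    * (Cphi / (a * T4GaugeActionRate.gam0 d ^ 2) + Real.pi ^ 2 / 24 / (a * T4GaugeActionRate.gam0 d))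

/-- the constant of the `(0,0)` x-corner rate: `π²/24 + Cdz`. [folklore] -/
def Cxz (d : ℕ) (a : ℝ) : ℝ := Real.pi ^ 2 / 24 + Cdz d a

omit [NeZero N] in
/-- `0 ≤ Cdz`, `0 ≤ Cxz`. [folklore] -/
theorem Cdz_nonneg (d : ℕ) {a : ℝ} (ha : 0 < a) : 0 ≤ Cdz d a ∧ 0 ≤ Cxz d a := by
  have hg := T4GaugeActionRate.gam0_pos d
  have hφ := B5ActionRate166.Cphi_pos
  have h1 : 0 ≤ CS1 := by unfold CS1; positivity
  have h2 : 0 ≤ Cdz d a := by unfold Cdz; positivity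
  exact ⟨h2, by unfold Cxz; positivity⟩

/-- **η-rate of the `(0,0)` x-corner** (King's `m = 0` term at `l = l′ = 0`):
`‖xEnt^{(N)}_μ(0,0) − xEnt^{(RN)}_μ(ι0, ι0)‖ ≤ Cxz·N⁻²`, from the rate of `Δ⁻¹(p′)`
(`B5G183RateSum.diag_paired_rate` at the zero class, i.e. King (4.10)) and of `dZ`
(`B5G183Rate.dZ_rate'`). [cite: King1986, (4.10) p.671, (4.21) p.672] [folklore] -/
theorem xEnt_zero_zero_rate (hN : 1 ≤ N) (hR : 1 ≤ R) (a : ℝ) (ha : 0 < a) (μ : Fin d)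
    {s : Fin d → ℝ} (hs : ∀ ν, |s ν| ≤ Real.pi) (hs0 : s ≠ 0) :
    ‖xEnt N a μ s 0 0 - xEnt (R * N) a μ s (iota R 0 s) (iota R 0 s)‖
      ≤ Cxz d a * ((N : ℝ) ^ 2)⁻¹ := by
  obtain ⟨ν₀, hν₀⟩ : ∃ ν, s ν ≠ 0 := Function.ne_iff.mp hs0
  have hRN : 1 ≤ R * N := le_trans hN (Nat.le_mul_of_pos_left N hR)
  have h1 := diag_paired_rate hN hR hs ν₀ hν₀ (0 : Fin d → Fin N)
  rw [symmAlias_zero hN hs] at h1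
  have h2 := dZ_rate' hN hR a ha μ hs ν₀ hν₀
  rw [iota_zero hN hs, xEnt_zero_zero hN a ha μ hs hs0, xEnt_zero_zero hRN a ha μ hs hs0]
  have e : ((((DeltaXir N 0 s : ℝ) : ℂ))⁻¹ - ((dZ N a μ s : ℝ) : ℂ))
      - ((((DeltaXir (R * N) 0 s : ℝ) : ℂ))⁻¹ - ((dZ (R * N) a μ s : ℝ) : ℂ))
      = ((((DeltaXir N 0 s)⁻¹ - (DeltaXir (R * N) 0 s)⁻¹)
          - (dZ N a μ s - dZ (R * N) a μ s) : ℝ) : ℂ) := by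
    push_cast; ring
  rw [e, Complex.norm_real, Real.norm_eq_abs]
  calc |((DeltaXir N 0 s)⁻¹ - (DeltaXir (R * N) 0 s)⁻¹) - (dZ N a μ s - dZ (R * N) a μ s)|
      ≤ |(DeltaXir N 0 s)⁻¹ - (DeltaXir (R * N) 0 s)⁻¹| + |dZ N a μ s - dZ (R * N) a μ s| :=
        abs_sub _ _
    _ ≤ Real.pi ^ 2 / 24 * ((N : ℝ) ^ 2)⁻¹
          + (CS1 / T4GaugeActionRate.gam0 d + (1 + a / 4) * (4 * d)
              * (Cphi / (a * T4GaugeActionRate.gam0 d ^ 2)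
                  + Real.pi ^ 2 / 24 / (a * T4GaugeActionRate.gam0 d))) * ((N : ℝ) ^ 2)⁻¹ :=
        add_le_add h1 h2
    _ = Cxz d a * ((N : ℝ) ^ 2)⁻¹ := by unfold Cxz Cdz; ring

/-- entrywise majorant of `Gfor`: `‖G_{(k,μ),(k′,ν)}‖ ≤ [μ=ν]([k=k′]Δ⁻¹(q_k) + ‖xEnt‖) + ‖rEnt‖`.
[folklore] -/
theorem norm_Gfor_le (a : ℝ) (s : Fin d → ℝ) (μ ν : Fin d) (k k' : Fin d → Fin n) :
    ‖Gfor n a s μ ν k k'‖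
      ≤ (if μ = ν then
            (if k = k' then (DeltaXir n 0 (symmAlias n k s))⁻¹ else 0) + ‖xEnt n a μ s k k'‖
          else 0) + ‖rEnt n a μ ν s k k'‖ := by
  have hΔ : 0 ≤ DeltaXir n 0 (symmAlias n k s) := DeltaXir_nonneg n 0 le_rfl _
  unfold Gfor
  by_cases hμ : μ = ν
  · simp only [hμ, if_true]
    by_cases hk : k = k'
    · simp only [hk, if_true]
      calc ‖((((DeltaXir n 0 (symmAlias n k' s) : ℝ) : ℂ))⁻¹ - xEnt n a ν s k' k') + rEnt n a ν ν s k' k'‖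
          ≤ ‖(((DeltaXir n 0 (symmAlias n k' s) : ℝ) : ℂ))⁻¹ - xEnt n a ν s k' k'‖ + ‖rEnt n a ν ν s k' k'‖ :=
            norm_add_le _ _
        _ ≤ (‖(((DeltaXir n 0 (symmAlias n k' s) : ℝ) : ℂ))⁻¹‖ + ‖xEnt n a ν s k' k'‖) + ‖rEnt n a ν ν s k' k'‖ := by
            gcongr; exact norm_sub_le _ _
        _ = _ := by
            subst hk
            rw [← Complex.ofReal_inv, Complex.norm_real, Real.norm_eq_abs, abs_of_nonneg (inv_nonneg.mpr hΔ)]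
    · simp only [hk, if_false, zero_sub]
      calc ‖-xEnt n a ν s k k' + rEnt n a ν ν s k k'‖
          ≤ ‖-xEnt n a ν s k k'‖ + ‖rEnt n a ν ν s k k'‖ := norm_add_le _ _
        _ = _ := by rw [norm_neg, zero_add]
  · simp only [hμ, if_false, zero_add]
    exact le_refl _

/-- entrywise majorant of the η-rate DIFFERENCE at paired classes:
`‖G^{(RN)}_{(ιk,μ),(ιk′,ν)} − G^{(N)}_{(k,μ),(k′,ν)}‖ ≤ [μ=ν]([k=k′]|Δ_N⁻¹ − Δ_RN⁻¹|(q_k) + ‖xEnt diff‖) + ‖rEnt diff‖`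
(the paired class `ιk` has the SAME representative `q_k`, `B5Hk163Rate.symmAlias_iota`).
[cite: King1986, (4.19)-(4.21) p.672] [folklore] -/
theorem norm_Gfor_sub_le (hN : 1 ≤ N) (a : ℝ) {s : Fin d → ℝ} (hs : ∀ ν, |s ν| ≤ Real.pi)
    (μ ν : Fin d) (k k' : Fin d → Fin N) :
    ‖Gfor (R * N) a s μ ν (iota R k s) (iota R k' s) - Gfor N a s μ ν k k'‖
      ≤ (if μ = ν then
            (if k = k' then
                |(DeltaXir N 0 (symmAlias N k s))⁻¹ - (DeltaXir (R * N) 0 (symmAlias N k s))⁻¹|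
              else 0)
              + ‖xEnt N a μ s k k' - xEnt (R * N) a μ s (iota R k s) (iota R k' s)‖
          else 0)
        + ‖rEnt N a μ ν s k k' - rEnt (R * N) a μ ν s (iota R k s) (iota R k' s)‖ := by
  have hinj : (iota R k s = iota R k' s) ↔ k = k' :=
    ⟨fun h => iota_injective hN hs h, fun h => by rw [h]⟩
  unfold Gfor
  rw [symmAlias_iota hN k hs]
  set xN := xEnt N a μ s k k'
  set xR := xEnt (R * N) a μ s (iota R k s) (iota R k' s)
  set rN := rEnt N a μ ν s k k'
  set rR := rEnt (R * N) a μ ν s (iota R k s) (iota R k' s)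
  set AN : ℂ := (((DeltaXir N 0 (symmAlias N k s) : ℝ) : ℂ))⁻¹
  set AR : ℂ := (((DeltaXir (R * N) 0 (symmAlias N k s) : ℝ) : ℂ))⁻¹
  have hA : ‖AR - AN‖ = |(DeltaXir N 0 (symmAlias N k s))⁻¹ - (DeltaXir (R * N) 0 (symmAlias N k s))⁻¹| := by
    rw [norm_sub_rev]
    simp only [AN, AR]
    rw [← Complex.ofReal_inv, ← Complex.ofReal_inv, ← Complex.ofReal_sub, Complex.norm_real,
      Real.norm_eq_abs]
  by_cases hμ : μ = ν
  · simp only [hμ, if_true]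
    by_cases hk : k = k'
    · have hι : iota R k s = iota R k' s := hinj.mpr hk
      simp only [hk, if_true]
      have e : (AR - xR + rR) - (AN - xN + rN) = (AR - AN) + (xN - xR) + -(rN - rR) := by ring
      rw [e]
      calc ‖(AR - AN) + (xN - xR) + -(rN - rR)‖
          ≤ ‖AR - AN‖ + ‖xN - xR‖ + ‖-(rN - rR)‖ := norm_add₃_le
        _ = _ := by
          rw [norm_neg, hA]
          subst hk; rfl
    · have hι : ¬ iota R k s = iota R k' s := fun h => hk (hinj.mp h)
      simp only [hk, hι, if_false, zero_sub, zero_add]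
      have e : (-xR + rR) - (-xN + rN) = (xN - xR) + -(rN - rR) := by ring
      rw [e]
      calc ‖(xN - xR) + -(rN - rR)‖ ≤ ‖xN - xR‖ + ‖-(rN - rR)‖ := norm_add_le _ _
        _ = _ := by rw [norm_neg]
  · simp only [hμ, if_false, zero_add]
    rw [norm_sub_rev]

end Entries

/-! ## §3 Row sums of the η-rate difference `G^{(RN)}(p′) − ι_* G^{(N)}(p′) ι^*` [folklore] -/

section Rows

variable {N R : ℕ} [NeZero N] [NeZero R]

omit [NeZero N] [NeZero R] in
/-- bookkeeping: `Σ_{k′} Σ_ν ([μ = ν]·A(k′) + B(ν,k′)) = Σ_{k′} A(k′) + Σ_ν Σ_{k′} B(ν,k′)`. [folklore] -/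
theorem sum_sum_ite_add {α : Type*} [Fintype α] (μ : Fin d) (A : α → ℝ) (B : Fin d → α → ℝ) :
    ∑ k', ∑ ν, ((if μ = ν then A k' else 0) + B ν k') = ∑ k', A k' + ∑ ν, ∑ k', B ν k' := by
  have h : ∀ k', ∑ ν, ((if μ = ν then A k' else 0) + B ν k') = A k' + ∑ ν, B ν k' := fun k' => by
    rw [Finset.sum_add_distrib, Finset.sum_ite_eq]; simp
  rw [Finset.sum_congr rfl fun k' _ => h k', Finset.sum_add_distrib, Finset.sum_comm]

omit [NeZero N] [NeZero R] in
/-- bookkeeping: `Σ_{k′} ([k = k′]·c + X(k′)) = c + Σ_{k′} X(k′)`. [folklore] -/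
theorem sum_ite_add {α : Type*} [Fintype α] [DecidableEq α] (k : α) (c : ℝ) (X : α → ℝ) :
    ∑ k', ((if k = k' then c else 0) + X k') = c + ∑ k', X k' := by
  rw [Finset.sum_add_distrib, Finset.sum_ite_eq]; simp

omit [NeZero N] [NeZero R] in
/-- `0 ≤ CXr, CX0r, CRr` (the rate constants of `B5G183RateSum`). [folklore] -/
theorem rate_consts_nonneg (hd : 0 < d) {a : ℝ} (ha : 0 < a) :
    0 ≤ CXr d ∧ 0 ≤ CX0r d ∧ 0 ≤ CRr d a := by
  have hg := T4GaugeActionRate.gam0_pos d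
  have hφ := B5ActionRate166.Cphi_pos
  obtain ⟨hSX, hSXe, hKX, hKXe, hSXu⟩ := x_consts_nonneg hd
  obtain ⟨hSB, hSBe, hSBu⟩ := b_consts_nonneg hd ha
  have hρX : 0 ≤ rhoX d := by unfold rhoX; positivity
  have hρB : 0 ≤ rhoB d := by unfold rhoB; positivity
  have hAx : 0 ≤ Ax d := by unfold Ax; positivity
  have hπ : 0 ≤ Real.pi ^ 2 / 4 / T4GaugeActionRate.gam0 d := by positivity
  have hq : 0 ≤ (4 * d + a) / a := by positivity
  refine ⟨?_, ?_, ?_⟩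
  · unfold CXr
    exact add_nonneg (add_nonneg (mul_nonneg (mul_nonneg hρX hSX) hKX) (mul_nonneg hSXe hKX))
      (mul_nonneg hSX hKXe)
  · unfold CX0r
    refine mul_nonneg hπ (add_nonneg (mul_nonneg (add_nonneg hρX ?_) hSX) hSXe)
    exact mul_nonneg hAx (by positivity)
  · unfold CRr
    exact mul_nonneg hq (add_nonneg (mul_nonneg (mul_nonneg hρB hSB) hSB)
      (mul_nonneg (by norm_num) (mul_nonneg hSBe hSB)))

/-- **paired row, paired columns** (King's `m = 0` terms): for the class `ιk` at level `RN`,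
`Σ_{k′} Σ_ν ‖G^{(RN)}_{(ιk,μ),(ιk′,ν)} − G^{(N)}_{(k,μ),(k′,ν)}‖ ≤ (π²/24 + Cxz)·N⁻² + (CX0r + CXr + d·CRr)/N`
— by `B5G183RateSum.diag_paired_rate`, `xBlock_rows_rate` / `xBlock_row0_rate` + the corner
`xEnt_zero_zero_rate`, and `rBlock_rate` (a single row is dominated by the double sum).
[cite: King1986, (4.19)-(4.21) p.672] [folklore] -/
theorem paired_row_paired_le (hN : 1 ≤ N) (hR : 1 ≤ R) (a : ℝ) (ha : 0 < a) {s : Fin d → ℝ}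
    (hs : ∀ ν, |s ν| ≤ Real.pi) (hs0 : s ≠ 0) (k : Fin d → Fin N) (μ : Fin d) :
    ∑ k' : Fin d → Fin N, ∑ ν : Fin d,
        ‖Gfor (R * N) a s μ ν (iota R k s) (iota R k' s) - Gfor N a s μ ν k k'‖
      ≤ (Real.pi ^ 2 / 24 + Cxz d a) * ((N : ℝ) ^ 2)⁻¹ + (CX0r d + CXr d + d * CRr d a) / N := by
  obtain ⟨ν₀, hν₀⟩ : ∃ ν, s ν ≠ 0 := Function.ne_iff.mp hs0
  have hd : 0 < d := Fin.pos ν₀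
  have hN0 : (0 : ℝ) < N := by exact_mod_cast hN
  obtain ⟨hCXr, hCX0r, hCRr⟩ := rate_consts_nonneg hd ha
  have hCxz := (Cdz_nonneg d ha).2
  -- Step 1: entrywise bound and evaluation of the indicator sums
  have h1 : ∑ k' : Fin d → Fin N, ∑ ν : Fin d,
        ‖Gfor (R * N) a s μ ν (iota R k s) (iota R k' s) - Gfor N a s μ ν k k'‖
      ≤ ∑ k' : Fin d → Fin N, ∑ ν : Fin d,
        ((if μ = ν then
            (if k = k' then
                |(DeltaXir N 0 (symmAlias N k s))⁻¹ - (DeltaXir (R * N) 0 (symmAlias N k s))⁻¹|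
              else 0)
              + ‖xEnt N a μ s k k' - xEnt (R * N) a μ s (iota R k s) (iota R k' s)‖
          else 0)
        + ‖rEnt N a μ ν s k k' - rEnt (R * N) a μ ν s (iota R k s) (iota R k' s)‖) :=
    Finset.sum_le_sum fun k' _ => Finset.sum_le_sum fun ν _ => norm_Gfor_sub_le hN a hs μ ν k k'
  rw [sum_sum_ite_add, sum_ite_add] at h1
  -- Step 2: the three pieces
  have hdg : |(DeltaXir N 0 (symmAlias N k s))⁻¹ - (DeltaXir (R * N) 0 (symmAlias N k s))⁻¹|
      ≤ Real.pi ^ 2 / 24 * ((N : ℝ) ^ 2)⁻¹ := diag_paired_rate hN hR hs ν₀ hν₀ k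
  have hx : ∑ k' : Fin d → Fin N, ‖xEnt N a μ s k k' - xEnt (R * N) a μ s (iota R k s) (iota R k' s)‖
      ≤ Cxz d a * ((N : ℝ) ^ 2)⁻¹ + CX0r d / N + CXr d / N := by
    by_cases hk : k = 0
    · subst hk
      rw [← Finset.add_sum_erase _ _ (Finset.mem_univ (0 : Fin d → Fin N))]
      have h00 := xEnt_zero_zero_rate hN hR a ha μ hs hs0 (R := R)
      have h0r := xBlock_row0_rate hN hR a ha μ hs ν₀ hν₀
      have : 0 ≤ CXr d / N := div_nonneg hCXr hN0.le
      linarith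
    · have hmem : k ∈ Finset.univ.erase (0 : Fin d → Fin N) :=
        Finset.mem_erase.mpr ⟨hk, Finset.mem_univ k⟩
      have hle : ∑ k' : Fin d → Fin N, ‖xEnt N a μ s k k' - xEnt (R * N) a μ s (iota R k s) (iota R k' s)‖
          ≤ ∑ k₁ ∈ Finset.univ.erase (0 : Fin d → Fin N), ∑ k' : Fin d → Fin N,
              ‖xEnt N a μ s k₁ k' - xEnt (R * N) a μ s (iota R k₁ s) (iota R k' s)‖ :=
        Finset.single_le_sum (f := fun k₁ => ∑ k' : Fin d → Fin N,
            ‖xEnt N a μ s k₁ k' - xEnt (R * N) a μ s (iota R k₁ s) (iota R k' s)‖)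
          (fun k₁ _ => Finset.sum_nonneg fun _ _ => norm_nonneg _) hmem
      have hrr := xBlock_rows_rate hN hR a ha μ hs ν₀ hν₀
      have : 0 ≤ CX0r d / N := div_nonneg hCX0r hN0.le
      have : 0 ≤ Cxz d a * ((N : ℝ) ^ 2)⁻¹ := by positivity
      linarith
  have hr : ∑ ν : Fin d, ∑ k' : Fin d → Fin N,
        ‖rEnt N a μ ν s k k' - rEnt (R * N) a μ ν s (iota R k s) (iota R k' s)‖ ≤ d * CRr d a / N := by
    have hν : ∀ ν : Fin d, ∑ k' : Fin d → Fin N,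
        ‖rEnt N a μ ν s k k' - rEnt (R * N) a μ ν s (iota R k s) (iota R k' s)‖ ≤ CRr d a / N := by
      intro ν
      have hle : ∑ k' : Fin d → Fin N,
            ‖rEnt N a μ ν s k k' - rEnt (R * N) a μ ν s (iota R k s) (iota R k' s)‖
          ≤ ∑ k₁ : Fin d → Fin N, ∑ k' : Fin d → Fin N,
              ‖rEnt N a μ ν s k₁ k' - rEnt (R * N) a μ ν s (iota R k₁ s) (iota R k' s)‖ :=
        Finset.single_le_sum (f := fun k₁ => ∑ k' : Fin d → Fin N,
            ‖rEnt N a μ ν s k₁ k' - rEnt (R * N) a μ ν s (iota R k₁ s) (iota R k' s)‖)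
          (fun k₁ _ => Finset.sum_nonneg fun _ _ => norm_nonneg _) (Finset.mem_univ k)
      exact hle.trans (rBlock_rate hN hR a ha μ ν hs ν₀ hν₀)
    calc ∑ ν : Fin d, ∑ k' : Fin d → Fin N,
          ‖rEnt N a μ ν s k k' - rEnt (R * N) a μ ν s (iota R k s) (iota R k' s)‖
        ≤ ∑ _ν : Fin d, CRr d a / N := Finset.sum_le_sum fun ν _ => hν ν
      _ = d * CRr d a / N := by
        rw [Finset.sum_const, Finset.card_univ, Fintype.card_fin, nsmul_eq_mul]; ring
  calc _ ≤ _ := h1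
    _ ≤ Real.pi ^ 2 / 24 * ((N : ℝ) ^ 2)⁻¹ + (Cxz d a * ((N : ℝ) ^ 2)⁻¹ + CX0r d / N + CXr d / N)
          + d * CRr d a / N := add_le_add (add_le_add hdg hx) hr
    _ = _ := by ring

/-- **paired row, UNPAIRED columns** (King's `|m| ≥ 1` terms): for the class `ιk` at level `RN`,
`Σ_{l″ unpaired} Σ_ν ‖G^{(RN)}_{(ιk,μ),(l″,ν)}‖ ≤ (KX·SXu + d·((4d+a)/a)·SB·SBu)/N`
(`B5G183RateSum.xBlock_unpaired_cols_le`, `rBlock_unpaired_cols_le`; the diagonal does not meet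
these columns). [cite: King1986, (4.23) p.672] [folklore] -/
theorem paired_row_unpaired_le (hN : 1 ≤ N) (hR : 1 ≤ R) (a : ℝ) (ha : 0 < a) {s : Fin d → ℝ}
    (hs : ∀ ν, |s ν| ≤ Real.pi) (hs0 : s ≠ 0) (k : Fin d → Fin N) (μ : Fin d) :
    ∑ l'' ∈ Finset.univ.filter (fun l'' => ∀ k₁ : Fin d → Fin N, iota R k₁ s ≠ l''), ∑ ν : Fin d,
        ‖Gfor (R * N) a s μ ν (iota R k s) l''‖
      ≤ (KX d * SXu d + d * ((4 * d + a) / a * SB d a * SBu d)) / N := by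
  obtain ⟨ν₀, hν₀⟩ : ∃ ν, s ν ≠ 0 := Function.ne_iff.mp hs0
  set U := Finset.univ.filter (fun l'' => ∀ k₁ : Fin d → Fin N, iota R k₁ s ≠ l'') with hU
  have h1 : ∑ l'' ∈ U, ∑ ν : Fin d, ‖Gfor (R * N) a s μ ν (iota R k s) l''‖
      ≤ ∑ l'' ∈ U, ∑ ν : Fin d,
          ((if μ = ν then ‖xEnt (R * N) a μ s (iota R k s) l''‖ else 0)
            + ‖rEnt (R * N) a μ ν s (iota R k s) l''‖) := by
    refine Finset.sum_le_sum fun l'' hl => Finset.sum_le_sum fun ν _ => ?_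
    have hu : iota R k s ≠ l'' := (Finset.mem_filter.mp hl).2 k
    have h := norm_Gfor_le a s μ ν (iota R k s) l'' (n := R * N)
    rw [if_neg hu, zero_add] at h
    exact h
  have h2 : ∑ l'' ∈ U, ∑ ν : Fin d,
          ((if μ = ν then ‖xEnt (R * N) a μ s (iota R k s) l''‖ else 0)
            + ‖rEnt (R * N) a μ ν s (iota R k s) l''‖)
      = ∑ l'' ∈ U, ‖xEnt (R * N) a μ s (iota R k s) l''‖
        + ∑ ν : Fin d, ∑ l'' ∈ U, ‖rEnt (R * N) a μ ν s (iota R k s) l''‖ := by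
    have h : ∀ l'', ∑ ν : Fin d,
          ((if μ = ν then ‖xEnt (R * N) a μ s (iota R k s) l''‖ else 0)
            + ‖rEnt (R * N) a μ ν s (iota R k s) l''‖)
        = ‖xEnt (R * N) a μ s (iota R k s) l''‖ + ∑ ν : Fin d, ‖rEnt (R * N) a μ ν s (iota R k s) l''‖ :=
      fun l'' => by rw [Finset.sum_add_distrib, Finset.sum_ite_eq]; simp
    rw [Finset.sum_congr rfl fun l'' _ => h l'', Finset.sum_add_distrib, Finset.sum_comm]
  have hx : ∑ l'' ∈ U, ‖xEnt (R * N) a μ s (iota R k s) l''‖ ≤ KX d * SXu d / N := by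
    have hle : ∑ l'' ∈ U, ‖xEnt (R * N) a μ s (iota R k s) l''‖
        ≤ ∑ l : Fin d → Fin (R * N), ∑ l'' ∈ U, ‖xEnt (R * N) a μ s l l''‖ :=
      Finset.single_le_sum (f := fun l => ∑ l'' ∈ U, ‖xEnt (R * N) a μ s l l''‖)
        (fun _ _ => Finset.sum_nonneg fun _ _ => norm_nonneg _) (Finset.mem_univ (iota R k s))
    exact hle.trans (xBlock_unpaired_cols_le hN hR a ha μ hs ν₀ hν₀)
  have hr : ∑ ν : Fin d, ∑ l'' ∈ U, ‖rEnt (R * N) a μ ν s (iota R k s) l''‖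
      ≤ d * ((4 * d + a) / a * SB d a * SBu d) / N := by
    have hν : ∀ ν : Fin d, ∑ l'' ∈ U, ‖rEnt (R * N) a μ ν s (iota R k s) l''‖
        ≤ (4 * d + a) / a * SB d a * SBu d / N := by
      intro ν
      have hle : ∑ l'' ∈ U, ‖rEnt (R * N) a μ ν s (iota R k s) l''‖
          ≤ ∑ l : Fin d → Fin (R * N), ∑ l'' ∈ U, ‖rEnt (R * N) a μ ν s l l''‖ :=
        Finset.single_le_sum (f := fun l => ∑ l'' ∈ U, ‖rEnt (R * N) a μ ν s l l''‖)
          (fun _ _ => Finset.sum_nonneg fun _ _ => norm_nonneg _) (Finset.mem_univ (iota R k s))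
      exact hle.trans (rBlock_unpaired_cols_le hN hR a ha μ ν hs ν₀ hν₀)
    calc ∑ ν : Fin d, ∑ l'' ∈ U, ‖rEnt (R * N) a μ ν s (iota R k s) l''‖
        ≤ ∑ _ν : Fin d, (4 * d + a) / a * SB d a * SBu d / N := Finset.sum_le_sum fun ν _ => hν ν
      _ = d * ((4 * d + a) / a * SB d a * SBu d) / N := by
        rw [Finset.sum_const, Finset.card_univ, Fintype.card_fin, nsmul_eq_mul]; ring
  calc _ ≤ _ := h1
    _ = _ := h2
    _ ≤ KX d * SXu d / N + d * ((4 * d + a) / a * SB d a * SBu d) / N := add_le_add hx hr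
    _ = _ := by ring

/-- **UNPAIRED row** (a class `k″ ≠ ιk` at level `RN`, `‖q_{k″}‖ ≥ πN`): the whole row of `G^{(RN)}`
is small, `Σ_{l″} Σ_ν ‖G^{(RN)}_{(k″,μ),(l″,ν)}‖ ≤ (4N²)⁻¹ + (SXu·KX + d·((4d+a)/a)·SBu·SB)/N`
(`B5G183RateSum.diag_unpaired_le`, `xBlock_unpaired_rows_le`, `rBlock_unpaired_rows_le`).
[cite: King1986, (4.23) p.672] [folklore] -/
theorem unpaired_row_le (hN : 1 ≤ N) (hR : 1 ≤ R) (a : ℝ) (ha : 0 < a) {s : Fin d → ℝ}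
    (hs : ∀ ν, |s ν| ≤ Real.pi) (hs0 : s ≠ 0) {k'' : Fin d → Fin (R * N)}
    (hu : ∀ k : Fin d → Fin N, iota R k s ≠ k'') (μ : Fin d) :
    ∑ l'' : Fin d → Fin (R * N), ∑ ν : Fin d, ‖Gfor (R * N) a s μ ν k'' l''‖
      ≤ ((4 : ℝ) * (N : ℝ) ^ 2)⁻¹ + (SXu d * KX d + d * ((4 * d + a) / a * SBu d * SB d a)) / N := by
  obtain ⟨ν₀, hν₀⟩ : ∃ ν, s ν ≠ 0 := Function.ne_iff.mp hs0
  set U := Finset.univ.filter (fun l'' => ∀ k₁ : Fin d → Fin N, iota R k₁ s ≠ l'') with hU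
  have hmem : k'' ∈ U := Finset.mem_filter.mpr ⟨Finset.mem_univ _, hu⟩
  have h1 : ∑ l'' : Fin d → Fin (R * N), ∑ ν : Fin d, ‖Gfor (R * N) a s μ ν k'' l''‖
      ≤ ∑ l'' : Fin d → Fin (R * N), ∑ ν : Fin d,
          ((if μ = ν then
              (if k'' = l'' then (DeltaXir (R * N) 0 (symmAlias (R * N) k'' s))⁻¹ else 0)
                + ‖xEnt (R * N) a μ s k'' l''‖
            else 0) + ‖rEnt (R * N) a μ ν s k'' l''‖) :=
    Finset.sum_le_sum fun l'' _ => Finset.sum_le_sum fun ν _ => norm_Gfor_le a s μ ν k'' l''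
  rw [sum_sum_ite_add, sum_ite_add] at h1
  have hdg : (DeltaXir (R * N) 0 (symmAlias (R * N) k'' s))⁻¹ ≤ ((4 : ℝ) * (N : ℝ) ^ 2)⁻¹ :=
    (diag_unpaired_le hN hR hs hu).2
  have hx : ∑ l'' : Fin d → Fin (R * N), ‖xEnt (R * N) a μ s k'' l''‖ ≤ SXu d * KX d / N := by
    have hle : ∑ l'' : Fin d → Fin (R * N), ‖xEnt (R * N) a μ s k'' l''‖
        ≤ ∑ k₂ ∈ U, ∑ l'' : Fin d → Fin (R * N), ‖xEnt (R * N) a μ s k₂ l''‖ :=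
      Finset.single_le_sum (f := fun k₂ => ∑ l'' : Fin d → Fin (R * N), ‖xEnt (R * N) a μ s k₂ l''‖)
        (fun _ _ => Finset.sum_nonneg fun _ _ => norm_nonneg _) hmem
    exact hle.trans (xBlock_unpaired_rows_le hN hR a ha μ hs ν₀ hν₀)
  have hr : ∑ ν : Fin d, ∑ l'' : Fin d → Fin (R * N), ‖rEnt (R * N) a μ ν s k'' l''‖
      ≤ d * ((4 * d + a) / a * SBu d * SB d a) / N := by
    have hν : ∀ ν : Fin d, ∑ l'' : Fin d → Fin (R * N), ‖rEnt (R * N) a μ ν s k'' l''‖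
        ≤ (4 * d + a) / a * SBu d * SB d a / N := by
      intro ν
      have hle : ∑ l'' : Fin d → Fin (R * N), ‖rEnt (R * N) a μ ν s k'' l''‖
          ≤ ∑ k₂ ∈ U, ∑ l'' : Fin d → Fin (R * N), ‖rEnt (R * N) a μ ν s k₂ l''‖ :=
        Finset.single_le_sum (f := fun k₂ => ∑ l'' : Fin d → Fin (R * N), ‖rEnt (R * N) a μ ν s k₂ l''‖)
          (fun _ _ => Finset.sum_nonneg fun _ _ => norm_nonneg _) hmem
      exact hle.trans (rBlock_unpaired_rows_le hN hR a ha μ ν hs ν₀ hν₀)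
    calc ∑ ν : Fin d, ∑ l'' : Fin d → Fin (R * N), ‖rEnt (R * N) a μ ν s k'' l''‖
        ≤ ∑ _ν : Fin d, (4 * d + a) / a * SBu d * SB d a / N := Finset.sum_le_sum fun ν _ => hν ν
      _ = d * ((4 * d + a) / a * SBu d * SB d a) / N := by
        rw [Finset.sum_const, Finset.card_univ, Fintype.card_fin, nsmul_eq_mul]; ring
  calc _ ≤ _ := h1
    _ ≤ ((4 : ℝ) * (N : ℝ) ^ 2)⁻¹ + SXu d * KX d / N + d * ((4 * d + a) / a * SBu d * SB d a) / N :=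
        add_le_add (add_le_add hdg hx) hr
    _ = _ := by ring

end Rows

/-! ## §4 THE OPERATOR-LEVEL η-RATE of the fibre of `G = Δ_a⁻¹` at `U = 1` [folklore] -/

section Operator

variable {N R : ℕ} [NeZero N] [NeZero R]

/-- constant of the PAIRED rows. [folklore] -/
def Cpr (d : ℕ) (a : ℝ) : ℝ :=
  Real.pi ^ 2 / 24 + Cxz d a + CX0r d + CXr d + d * CRr d a
    + (KX d * SXu d + d * ((4 * d + a) / a * SB d a * SBu d))

/-- constant of the UNPAIRED rows. [folklore] -/
def Cur (d : ℕ) (a : ℝ) : ℝ := 1 / 4 + (SXu d * KX d + d * ((4 * d + a) / a * SBu d * SB d a))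

/-- **the η-rate constant at operator level** (ours; depends on `d` and `a` only). [folklore] -/
def Cop (d : ℕ) (a : ℝ) : ℝ := Cpr d a + Cur d a

omit [NeZero N] [NeZero R] in
/-- `0 ≤ Cpr, Cur, Cop`. [folklore] -/
theorem Cop_nonneg (hd : 0 < d) {a : ℝ} (ha : 0 < a) : 0 ≤ Cpr d a ∧ 0 ≤ Cur d a ∧ 0 ≤ Cop d a := by
  obtain ⟨hCXr, hCX0r, hCRr⟩ := rate_consts_nonneg hd ha
  have hCxz := (Cdz_nonneg d ha).2
  obtain ⟨hSX, hSXe, hKX, hKXe, hSXu⟩ := x_consts_nonneg hd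
  obtain ⟨hSB, hSBe, hSBu⟩ := b_consts_nonneg hd ha
  have hq : 0 ≤ (4 * d + a) / a := by positivity
  have hd0 : (0 : ℝ) ≤ d := Nat.cast_nonneg d
  have h1 : 0 ≤ Cpr d a := by
    unfold Cpr
    have : 0 ≤ KX d * SXu d + d * ((4 * d + a) / a * SB d a * SBu d) :=
      add_nonneg (mul_nonneg hKX hSXu) (mul_nonneg hd0 (mul_nonneg (mul_nonneg hq hSB) hSBu))
    have : 0 ≤ (d : ℝ) * CRr d a := mul_nonneg hd0 hCRr
    positivity
  have h2 : 0 ≤ Cur d a := by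
    unfold Cur
    have : 0 ≤ SXu d * KX d + d * ((4 * d + a) / a * SBu d * SB d a) :=
      add_nonneg (mul_nonneg hSXu hKX) (mul_nonneg hd0 (mul_nonneg (mul_nonneg hq hSBu) hSB))
    positivity
  exact ⟨h1, h2, by unfold Cop; positivity⟩

/-- **every row sum of `|G^{(RN)}(p′) − ι_* G^{(N)}(p′) ι^*|` is `≤ Cop/N`.** [cite: King1986, (4.19)-(4.23) p.672] [folklore] -/
theorem row_sum_le (hN : 1 ≤ N) (hR : 1 ≤ R) (hRN : 1 ≤ R * N) (a : ℝ) (ha : 0 < a)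
    {s : Fin d → ℝ} (hs : ∀ ν, |s ν| ≤ Real.pi) (hs0 : s ≠ 0)
    (i : (Fin d → Fin (R * N)) × Fin d) :
    ∑ j, ‖((balabanFiber (R * N) hRN a ha s hs hs0).G
            - plant R s (balabanFiber N hN a ha s hs hs0).G) i j‖ ≤ Cop d a / N := by
  obtain ⟨k'', μ⟩ := i
  obtain ⟨ν₀, hν₀⟩ : ∃ ν, s ν ≠ 0 := Function.ne_iff.mp hs0
  have hd : 0 < d := Fin.pos ν₀
  have hN0 : (0 : ℝ) < N := by exact_mod_cast hN
  obtain ⟨hCpr, hCur, _⟩ := Cop_nonneg hd ha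
  rw [Fintype.sum_prod_type]
  simp only [Matrix.sub_apply]
  by_cases hp : ∃ k : Fin d → Fin N, iota R k s = k''
  · -- a PAIRED row `k″ = ιk`
    obtain ⟨k, rfl⟩ := hp
    rw [sum_split_iota hN hs (fun l'' => ∑ ν : Fin d,
      ‖(balabanFiber (R * N) hRN a ha s hs hs0).G (iota R k s, μ) (l'', ν)
          - plant R s (balabanFiber N hN a ha s hs hs0).G (iota R k s, μ) (l'', ν)‖)]
    have hA : ∑ k' : Fin d → Fin N, ∑ ν : Fin d,
          ‖(balabanFiber (R * N) hRN a ha s hs hs0).G (iota R k s, μ) (iota R k' s, ν)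
              - plant R s (balabanFiber N hN a ha s hs hs0).G (iota R k s, μ) (iota R k' s, ν)‖
        = ∑ k' : Fin d → Fin N, ∑ ν : Fin d,
            ‖Gfor (R * N) a s μ ν (iota R k s) (iota R k' s) - Gfor N a s μ ν k k'‖ := by
      refine Finset.sum_congr rfl fun k' _ => Finset.sum_congr rfl fun ν _ => ?_
      rw [G_entry, plant_iota_iota hN hs, G_entry]
    have hB : ∑ l'' ∈ Finset.univ.filter (fun l'' => ∀ k₁ : Fin d → Fin N, iota R k₁ s ≠ l''),
          ∑ ν : Fin d,
            ‖(balabanFiber (R * N) hRN a ha s hs hs0).G (iota R k s, μ) (l'', ν)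
                - plant R s (balabanFiber N hN a ha s hs hs0).G (iota R k s, μ) (l'', ν)‖
        = ∑ l'' ∈ Finset.univ.filter (fun l'' => ∀ k₁ : Fin d → Fin N, iota R k₁ s ≠ l''),
            ∑ ν : Fin d, ‖Gfor (R * N) a s μ ν (iota R k s) l''‖ := by
      refine Finset.sum_congr rfl fun l'' hl => Finset.sum_congr rfl fun ν _ => ?_
      have hu := (Finset.mem_filter.mp hl).2
      rw [G_entry, plant_col_unpaired _ _ hu, sub_zero]
    rw [hA, hB]
    have hsq : (Real.pi ^ 2 / 24 + Cxz d a) * ((N : ℝ) ^ 2)⁻¹ ≤ (Real.pi ^ 2 / 24 + Cxz d a) / N :=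
      mul_inv_sq_le_div (by have := (Cdz_nonneg d ha).2; positivity) hN
    calc _ ≤ ((Real.pi ^ 2 / 24 + Cxz d a) * ((N : ℝ) ^ 2)⁻¹ + (CX0r d + CXr d + d * CRr d a) / N)
            + (KX d * SXu d + d * ((4 * d + a) / a * SB d a * SBu d)) / N :=
          add_le_add (paired_row_paired_le hN hR a ha hs hs0 k μ)
            (paired_row_unpaired_le hN hR a ha hs hs0 k μ)
      _ ≤ ((Real.pi ^ 2 / 24 + Cxz d a) / N + (CX0r d + CXr d + d * CRr d a) / N)
            + (KX d * SXu d + d * ((4 * d + a) / a * SB d a * SBu d)) / N := by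
          gcongr
      _ = Cpr d a / N := by unfold Cpr; field_simp; ring
      _ ≤ Cop d a / N := by
          unfold Cop
          exact div_le_div_of_nonneg_right (le_add_of_nonneg_right hCur) hN0.le
  · -- an UNPAIRED row
    push Not at hp
    have hA : ∑ l'' : Fin d → Fin (R * N), ∑ ν : Fin d,
          ‖(balabanFiber (R * N) hRN a ha s hs hs0).G (k'', μ) (l'', ν)
              - plant R s (balabanFiber N hN a ha s hs hs0).G (k'', μ) (l'', ν)‖
        = ∑ l'' : Fin d → Fin (R * N), ∑ ν : Fin d, ‖Gfor (R * N) a s μ ν k'' l''‖ := by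
      refine Finset.sum_congr rfl fun l'' _ => Finset.sum_congr rfl fun ν _ => ?_
      rw [G_entry, plant_row_unpaired _ hp, sub_zero]
    rw [hA]
    have hsq : ((4 : ℝ) * (N : ℝ) ^ 2)⁻¹ ≤ (1 / 4) / N := by
      rw [show ((4 : ℝ) * (N : ℝ) ^ 2)⁻¹ = 1 / 4 * ((N : ℝ) ^ 2)⁻¹ by rw [mul_inv, one_div]]
      exact mul_inv_sq_le_div (by norm_num) hN
    calc _ ≤ ((4 : ℝ) * (N : ℝ) ^ 2)⁻¹
            + (SXu d * KX d + d * ((4 * d + a) / a * SBu d * SB d a)) / N :=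
          unpaired_row_le hN hR a ha hs hs0 hp μ
      _ ≤ (1 / 4) / N + (SXu d * KX d + d * ((4 * d + a) / a * SBu d * SB d a)) / N := by
          gcongr
      _ = Cur d a / N := by unfold Cur; field_simp
      _ ≤ Cop d a / N := by
          unfold Cop
          exact div_le_div_of_nonneg_right (le_add_of_nonneg_left hCpr) hN0.le

/-- **THE η-RATE OF THE FIBRE OF `G = Δ_a⁻¹` AT `U = 1`, OPERATOR FORM.** For `N ≥ 1`, `R ≥ 1`,
`a > 0` and a fibre `p′ = s ≠ 0` of the zone, the `ℓ² → ℓ²` operator norm (on the level-`RN`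
alias classes `× Fin d`) of the difference between Bałaban's fibre matrix (1.83) at lattice
spacing `η′ = 1/(RN)` and the level-`N` fibre matrix PLANTED on the paired classes (King's
`m = 0` identification, zero on the `|m| ≥ 1` classes) is `≤ Cop(d,a)/N`:
`‖G^{(RN)}(p′) − ι_* G^{(N)}(p′) ι^*‖ ≤ Cop/N`. Schur test (`opNorm_le_of_schur_isHermitian`,
both matrices Hermitian by b05's `B5Prop11Fiber.G_isHermitian`) over the row sums `row_sum_le`.
Companion (in the tree, b05): the UNIFORM bound `B5Prop11Fiber.opNorm_G_le : ‖G^{(n)}(p′)‖ ≤ gamma0 d a`.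
[cite: Balaban1984PropagatorsI, (1.83) p.31, Prop. 1.1 p.33; King1986, (4.19)-(4.23) p.672 (rate bookkeeping ours)] [folklore] -/
theorem opNorm_G_rate (hN : 1 ≤ N) (hR : 1 ≤ R) (hRN : 1 ≤ R * N) (a : ℝ) (ha : 0 < a)
    {s : Fin d → ℝ} (hs : ∀ ν, |s ν| ≤ Real.pi) (hs0 : s ≠ 0) :
    ‖(balabanFiber (R * N) hRN a ha s hs hs0).G - plant R s (balabanFiber N hN a ha s hs hs0).G‖
      ≤ Cop d a / N := by
  obtain ⟨ν₀, hν₀⟩ : ∃ ν, s ν ≠ 0 := Function.ne_iff.mp hs0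
  have hd : 0 < d := Fin.pos ν₀
  have hH : ((balabanFiber (R * N) hRN a ha s hs hs0).G
      - plant R s (balabanFiber N hN a ha s hs hs0).G).IsHermitian :=
    (G_isHermitian (R * N) hRN a ha s hs hs0).sub (plant_isHermitian (G_isHermitian N hN a ha s hs hs0))
  have hC : 0 ≤ Cop d a / N := div_nonneg (Cop_nonneg hd ha).2.2 (Nat.cast_nonneg N)
  exact opNorm_le_of_schur_isHermitian hH hC (row_sum_le hN hR hRN a ha hs hs0)

/-- the same with `1 ≤ R·N` discharged. [folklore] -/
theorem opNorm_G_rate' (hN : 1 ≤ N) (hR : 1 ≤ R) (a : ℝ) (ha : 0 < a)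
    {s : Fin d → ℝ} (hs : ∀ ν, |s ν| ≤ Real.pi) (hs0 : s ≠ 0) :
    ‖(balabanFiber (R * N) (le_trans hN (Nat.le_mul_of_pos_left N hR)) a ha s hs hs0).G
        - plant R s (balabanFiber N hN a ha s hs hs0).G‖ ≤ Cop d a / N :=
  opNorm_G_rate hN hR _ a ha hs hs0

/-- **uniform bound AND rate, side by side** (the η-rate linear theory of `G` at `U = 1`, fibrewise):
`‖G^{(N)}(p′)‖ ≤ γ₀(d,a)` (b05, `B5Prop11Fiber.opNorm_G_le`) and
`‖G^{(RN)}(p′) − ι_* G^{(N)}(p′) ι^*‖ ≤ Cop(d,a)/N` (this module), for all `N, R ≥ 1`, `p′ ≠ 0` in the zone.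
[cite: Balaban1984PropagatorsI, Prop. 1.1 (1.89) p.33; King1986, (4.19)-(4.23) p.672] [folklore] -/
theorem opNorm_G_le_and_rate (hN : 1 ≤ N) (hR : 1 ≤ R) (hRN : 1 ≤ R * N) (a : ℝ) (ha : 0 < a)
    {s : Fin d → ℝ} (hs : ∀ ν, |s ν| ≤ Real.pi) (hs0 : s ≠ 0) :
    ‖(balabanFiber N hN a ha s hs hs0).G‖ ≤ gamma0 d a
      ∧ ‖(balabanFiber (R * N) hRN a ha s hs hs0).G - plant R s (balabanFiber N hN a ha s hs hs0).G‖
          ≤ Cop d a / N :=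
  ⟨opNorm_G_le N hN a ha s hs hs0, opNorm_G_rate hN hR hRN a ha hs hs0⟩

end Operator

end Literature.MathematicalPhysics.QuantumFieldTheory.Balaban1983to89.B5G183RateOp
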